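import Literature.MathematicalPhysics.QuantumLattice.HubbardSectorFieldSubstitution
import Mathlib.Analysis.InnerProductSpace.PiL2
import HarnessLib

/-!
# The sectorised propagators of a normal charged covariance: charge structure and Gram form

Topic `MathematicalPhysics/QuantumLattice`; discharges, for the momentum-diagonal CHARGE-CONJUGATION-paired
("normal") covariances of the Hubbard torus — e.g. the free covariance and its cutoff slices at zero seed,
`hubbardCovariance L M β μ 0 = normalCovariance (βL² G₁₁)` — two of the three hypotheses of the single-scale step
`SectorisedEffectiveActionBound.hubbardSectorKernelNorm_effAction_le_of_sectorNorm` on the pulled-back covariance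
`C' = Sᵀ C S` of the auxiliary sector fields (`S = sectorSubMatrix β F`; Benfatto–Giuliani–Mastropietro 2006,
(2.66)–(2.67) and (2.80)):

* `normalCovariance p` — `C(((k,σ),c),((k',σ'),c')) = δ_{(k,σ),(k',σ')} (δ_{c0}δ_{c'1} - δ_{c1}δ_{c'0}) p(k,σ)`;
  `normalCovariance_transpose` (antisymmetry); **`hubbardCovariance_zero_seed`**, `hubbardCovAbove_zero_seed`,
  `hubbardCovSlice_zero_seed` (the zero-seed free covariance and its slices ARE normal, symbol
  `βL²·w(k)·(iω + ξ)/(ω² + ξ²)`);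
* **`sectorSub_pullback_normalCovariance_apply`** — the sectorised propagators in closed form,
  `C'((x,((ω,σ),c)),(y,((ω',σ'),c'))) = δ_{σσ'}(δ_{c0}δ_{c'1} g_{ωω'σ}(x,y) - δ_{c1}δ_{c'0} g_{ω'ωσ}(y,x))`,
  `g_{ωω'σ}(x,y) = (βL²)⁻² Σ_k F_ω(k) F_{ω'}(k) p(k,σ) conj(e^{-ik·x}) conj(e^{+ik·y})` (a finite Fourier sum of the
  symbol cut off to the two sectors — the lattice form of (2.66)–(2.67));
* the CHARGE hypothesis: `pullback_normalCovariance_eq_zero_of_charge_eq` (`q = [c = 0]`);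
* the GRAM hypothesis: vectors `sectorGramF`, `sectorGramG` in `EuclideanSpace ℂ (FreqMomentum L M × Fin 2)` with
  **`contr_pullback_normalCovariance_eq_inner`** (`contr C' X Y = ⟪F_X, G_Y⟫` for `X` of charge `0`, `Y` of
  charge `1`) and **`norm_sq_sectorGramF/G`** (`‖F_X‖² = (βL²)⁻² Σ_k ‖F_ω(k)‖² ‖p(k,σ)‖`: the sector phase-space sum
  of the symbol, whose size `≍ γ^{3h/2}` at scale `h` is (2.80)).

The third hypothesis (row/column sums `α` of `‖C'‖`, (2.81)) and the value of the phase-space sums are analysis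
(Lemma 2.2 on the lattice) and are not asserted here.  Everything below is proved; the definitions are
`normalCovariance` and the two Gram vectors; no named facts.

## Sources

G. Benfatto, A. Giuliani, V. Mastropietro, Ann. Henri Poincaré 7 (2006) 809–898, §2.1 (2.2)–(2.3), §2.7
(2.66)–(2.67a), §2.8 (2.80) [`BenfattoGiulianiMastropietro2006`]; G. Benfatto, A. Giuliani, V. Mastropietro, Ann.
Henri Poincaré 4 (2003) 137–193, §3 (3.50)–(3.52) [`BenfattoGiulianiMastropietro2003`].
-/

noncomputable section

namespace Literature.MathematicalPhysics.QuantumLattice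

open GrassmannAlgebra Finset Literature.Probability.LatticeModels
open scoped InnerProductSpace ComplexConjugate

/-! ### Normal charged covariances -/

section Normal

variable (L M : ℕ)

/-- A **normal charged covariance** with symbol `p`: momentum- and spin-diagonal, pairing only `ψ⁺` with `ψ⁻`,
antisymmetric: `C(((k,σ),c),((k',σ'),c')) = δ_{(k,σ),(k',σ')} (δ_{c0}δ_{c'1} - δ_{c1}δ_{c'0}) p(k,σ)`
(BGM 2006, (2.2)–(2.3): `∫P(dψ) ψ̂⁻_{kσ}ψ̂⁺_{k'σ'} = βL²δδ ĝ(k)`). [cite: BenfattoGiulianiMastropietro2006, §2.1 (2.3)] -/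
def normalCovariance (p : FreqMomentum L M × Fin 2 → ℂ) : Matrix (HubbardFieldIdx L M) (HubbardFieldIdx L M) ℂ :=
  Matrix.of fun X Y => if X.1 = Y.1 then
    (if X.2 = 0 ∧ Y.2 = 1 then p X.1 else if X.2 = 1 ∧ Y.2 = 0 then -p X.1 else 0) else 0

variable {L M}

/-- Unfolding `normalCovariance`. [folklore] -/
theorem normalCovariance_apply (p : FreqMomentum L M × Fin 2 → ℂ) (X Y : HubbardFieldIdx L M) :
    normalCovariance L M p X Y = if X.1 = Y.1 then
      (if X.2 = 0 ∧ Y.2 = 1 then p X.1 else if X.2 = 1 ∧ Y.2 = 0 then -p X.1 else 0) else 0 := rfl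

/-- A normal covariance vanishes between fields of equal charge. [folklore] -/
theorem normalCovariance_apply_of_charge_eq (p : FreqMomentum L M × Fin 2 → ℂ) {X Y : HubbardFieldIdx L M}
    (h : X.2 = Y.2) : normalCovariance L M p X Y = 0 := by
  rw [normalCovariance_apply]
  split_ifs with h1 h2 h3
  · exact absurd (h2.1.symm.trans (h.trans h2.2)) Fin.zero_ne_one
  · exact absurd (h3.2.symm.trans (h.symm.trans h3.1)) Fin.zero_ne_one
  · rfl
  · rfl

/-- **Normal covariances are antisymmetric.** [folklore] -/
theorem normalCovariance_transpose (p : FreqMomentum L M × Fin 2 → ℂ) :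
    (normalCovariance L M p).transpose = -normalCovariance L M p := by
  ext X Y
  rw [Matrix.transpose_apply, Matrix.neg_apply, normalCovariance_apply, normalCovariance_apply]
  by_cases h : Y.1 = X.1
  · rw [if_pos h, if_pos h.symm, h]
    by_cases h1 : Y.2 = 0 ∧ X.2 = 1
    · rw [if_pos h1, if_neg (fun h' => Fin.zero_ne_one (h1.1.symm.trans h'.2)), if_pos ⟨h1.2, h1.1⟩, neg_neg]
    · rw [if_neg h1]
      by_cases h2 : Y.2 = 1 ∧ X.2 = 0
      · rw [if_pos h2, if_pos ⟨h2.2, h2.1⟩]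
      · rw [if_neg h2, if_neg (fun h' => h2 ⟨h'.2, h'.1⟩), if_neg (fun h' => h1 ⟨h'.2, h'.1⟩), neg_zero]
  · rw [if_neg h, if_neg (fun h' => h h'.symm), neg_zero]

/-- Scaling the symbol scales the covariance. [folklore] -/
theorem normalCovariance_smul_symbol (w : FreqMomentum L M × Fin 2 → ℂ) (p : FreqMomentum L M × Fin 2 → ℂ)
    (X Y : HubbardFieldIdx L M) :
    normalCovariance L M (fun ks => w ks * p ks) X Y = w X.1 * normalCovariance L M p X Y := by
  rw [normalCovariance_apply, normalCovariance_apply]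
  split_ifs <;> ring

/-- Normal covariances are additive in the symbol. [folklore] -/
theorem normalCovariance_sub_symbol (p p' : FreqMomentum L M × Fin 2 → ℂ) :
    normalCovariance L M (fun ks => p ks - p' ks) = normalCovariance L M p - normalCovariance L M p' := by
  ext X Y
  rw [Matrix.sub_apply, normalCovariance_apply, normalCovariance_apply, normalCovariance_apply]
  split_ifs <;> ring

end Normal

/-! ### The zero-seed free covariance is normal -/

section ZeroSeed

variable {L M : ℕ} [NeZero L]

/-- The sign `s_a = ±1` of the Nambu index (`+` for the first component). [folklore] -/
def nambuSign (a : Fin 2) : ℝ := if a = 0 then 1 else -1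

/-- `s_0 = 1`. [folklore] -/
@[simp] theorem nambuSign_zero : nambuSign 0 = 1 := rfl

/-- `s_1 = -1`. [folklore] -/
@[simp] theorem nambuSign_one : nambuSign 1 = -1 := rfl

omit [NeZero L] in
/-- At zero seed the Nambu propagator is diagonal: `G_{ab}(k) = δ_{ab} (iω + s_a ξ)/(ω² + ξ²)`. [folklore] -/
theorem nambuPropagator_zero_seed_apply (β μ : ℝ) (k : FreqMomentum L M) (a b : Fin 2) :
    nambuPropagator L M β μ 0 k a b =
      if a = b then (Complex.I * matsubaraFreq β M k.1 + nambuSign a * nambuXi L μ k.2) / nambuDen L M β μ 0 k else 0 := by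
  fin_cases a <;> fin_cases b <;>
    simp [nambuPropagator, Matrix.cons_val', Matrix.cons_val_zero, Matrix.cons_val_fin_one, sub_eq_add_neg]

/-- The BCS denominator is even and seed-free at `h = 0`: `den(-k) = den(k) = ω² + ξ²`. [folklore] -/
theorem nambuDen_zero_seed_neg (β μ : ℝ) (k : FreqMomentum L M) :
    nambuDen L M β μ 0 k.neg = nambuDen L M β μ 0 k := by
  simp only [nambuDen, FreqMomentum.neg, matsubaraFreq_rev, neg_sq, nambuXi, torusBand_neg, zero_mul]

omit [NeZero L] in
/-- The zero-seed Nambu two-point table: `⟨Ψ⁻_{k,a}Ψ⁺_{k',b}⟩ = βL² δ_{kk'} δ_{ab} (iω + s_a ξ)/(ω² + ξ²)`. [folklore] -/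
theorem nambuTwoPoint_zero_seed (β μ : ℝ) (A B : (FreqMomentum L M × Fin 2) × Fin 2) :
    nambuTwoPoint L M β μ 0 A B = if A.2 = 1 ∧ B.2 = 0 ∧ A.1 = B.1 then
      ((β * (L : ℝ) ^ 2 : ℝ) : ℂ) * ((Complex.I * matsubaraFreq β M A.1.1.1 + nambuSign A.1.2 * nambuXi L μ A.1.1.2) /
        nambuDen L M β μ 0 A.1.1) else 0 := by
  rw [nambuTwoPoint]
  by_cases h : A.2 = 1 ∧ B.2 = 0 ∧ A.1.1 = B.1.1
  · rw [if_pos h, nambuPropagator_zero_seed_apply]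
    by_cases hab : A.1.2 = B.1.2
    · rw [if_pos hab, if_pos ⟨h.1, h.2.1, Prod.ext h.2.2 hab⟩]
    · rw [if_neg hab, mul_zero, if_neg (fun h' => hab (congrArg Prod.snd h'.2.2))]
  · rw [if_neg h, if_neg (fun h' => h ⟨h'.1, h'.2.1, congrArg Prod.fst h'.2.2⟩)]

/-- **The zero-seed free two-point table** `⟨ψ_X ψ_Y⟩₀` in the original labels: only `ψ⁻_{kσ}ψ⁺_{kσ}` (value
`βL² G₁₁(k)`) and `ψ⁺_{kσ}ψ⁻_{kσ}` (value `-βL² G₁₁(k)`) survive, for both spins. [cite: BenfattoGiulianiMastropietro2006, §2.1 (2.3)] -/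
theorem hubbardTwoPoint_zero_seed (β μ : ℝ) (X Y : HubbardFieldIdx L M) :
    hubbardTwoPoint L M β μ 0 X Y = if X.1 = Y.1 then
      (if X.2 = 1 ∧ Y.2 = 0 then 1 else if X.2 = 0 ∧ Y.2 = 1 then -1 else 0) *
        (((β * (L : ℝ) ^ 2 : ℝ) : ℂ) * ((Complex.I * matsubaraFreq β M X.1.1.1 + nambuXi L μ X.1.1.2) / nambuDen L M β μ 0 X.1.1))
      else 0 := by
  obtain ⟨⟨k, σ⟩, c⟩ := X
  obtain ⟨⟨k', σ'⟩, c'⟩ := Y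
  have hnegk : k.neg = k'.neg ↔ k = k' :=
    ⟨fun h => by simpa using congrArg FreqMomentum.neg h, fun h => by rw [h]⟩
  have hneg1 : matsubaraFreq β M k.neg.1 = -matsubaraFreq β M k.1 := matsubaraFreq_rev β k.1
  have hneg2 : nambuXi L μ k.neg.2 = nambuXi L μ k.2 := by simp [FreqMomentum.neg, nambuXi, torusBand_neg]
  have hneg1' : matsubaraFreq β M k'.neg.1 = -matsubaraFreq β M k'.1 := matsubaraFreq_rev β k'.1
  have hneg2' : nambuXi L μ k'.neg.2 = nambuXi L μ k'.2 := by simp [FreqMomentum.neg, nambuXi, torusBand_neg]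
  rw [hubbardTwoPoint, nambuTwoPoint_zero_seed, nambuTwoPoint_zero_seed]
  fin_cases σ <;> fin_cases σ'
  · -- `↑↑`: the Nambu relabelling is the identity
    fin_cases c <;> fin_cases c' <;> simp [toNambu, Prod.ext_iff, eq_comm]
    all_goals
      split_ifs with h <;> [(obtain ⟨h1, h2⟩ := h; rw [show k' = k from (Prod.ext h1 h2).symm]); simp]
  · -- `↑↓`
    fin_cases c <;> fin_cases c' <;> simp [toNambu, Prod.ext_iff]
  · -- `↓↑`
    fin_cases c <;> fin_cases c' <;> simp [toNambu, Prod.ext_iff]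
  · -- `↓↓`: momenta reflected, charges flipped, `G₂₂(-k) = -G₁₁(k)`
    fin_cases c <;> fin_cases c' <;>
      simp [toNambu, Prod.ext_iff, Fin.rev, hnegk, eq_comm, hneg1, hneg2, hneg1', hneg2', nambuDen_zero_seed_neg]
    all_goals
      split_ifs with h <;>
        [(obtain ⟨h1, h2⟩ := h; (try rw [show k' = k from (Prod.ext h1 h2).symm]); ring); simp]

/-- **The zero-seed free covariance is normal** with symbol `βL² G₁₁(k) = βL² (iω + ξ)/(ω² + ξ²)` for both spins
(BGM 2006, (2.3)). [cite: BenfattoGiulianiMastropietro2006, §2.1 (2.3)] -/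
theorem hubbardCovariance_zero_seed (β μ : ℝ) :
    hubbardCovariance L M β μ 0 = normalCovariance L M (fun ks =>
      ((β * (L : ℝ) ^ 2 : ℝ) : ℂ) * ((Complex.I * matsubaraFreq β M ks.1.1 + nambuXi L μ ks.1.2) / nambuDen L M β μ 0 ks.1)) := by
  ext X Y
  rw [hubbardCovariance, Matrix.of_apply, hubbardTwoPoint_zero_seed, normalCovariance_apply]
  by_cases h : X.1 = Y.1
  · rw [if_pos h, if_pos h]
    by_cases hA : X.2 = 1 ∧ Y.2 = 0
    · rw [if_pos hA, if_neg (fun hB => Fin.zero_ne_one (hB.1.symm.trans hA.1)), if_pos hA]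
      ring
    · rw [if_neg hA]
      by_cases hB : X.2 = 0 ∧ Y.2 = 1
      · rw [if_pos hB, if_pos hB]
        ring
      · rw [if_neg hB, if_neg hB, if_neg hA]
        ring
  · rw [if_neg h, if_neg h, neg_zero]

/-- **The zero-seed cutoff covariances are normal**: `C_{>Λ}` at `h = 0` has symbol `w_Λ(k) · βL² G₁₁(k)`.
[cite: Salmhofer1999, §4.2.5 (4.70)] -/
theorem hubbardCovAbove_zero_seed (β μ Λ : ℝ) :
    hubbardCovAbove L M β μ 0 Λ = normalCovariance L M (fun ks => (hubbardCutoffWeight L M β μ Λ ks.1 : ℂ) *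
      (((β * (L : ℝ) ^ 2 : ℝ) : ℂ) * ((Complex.I * matsubaraFreq β M ks.1.1 + nambuXi L μ ks.1.2) / nambuDen L M β μ 0 ks.1))) := by
  ext X Y
  rw [normalCovariance_smul_symbol, ← hubbardCovariance_zero_seed, hubbardCovAbove, Matrix.of_apply]
  by_cases h : X.1 = Y.1
  · have hk : momentumOf L M Y = momentumOf L M X := by simp only [momentumOf, h]
    rw [hk, momentumOf]
    push_cast
    ring
  · have h0 : hubbardCovariance L M β μ 0 X Y = 0 := by
      rw [hubbardCovariance_zero_seed, normalCovariance_apply, if_neg h]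
    rw [h0, mul_zero, mul_zero]

/-- The zero-seed slice covariance `C_{(Λ,Λ']}` is normal with symbol `(w_Λ - w_{Λ'}) · βL² G₁₁`. [folklore] -/
theorem hubbardCovSlice_zero_seed (β μ Λ Λ' : ℝ) :
    hubbardCovSlice L M β μ 0 Λ Λ' = normalCovariance L M (fun ks =>
      ((hubbardCutoffWeight L M β μ Λ ks.1 : ℂ) - (hubbardCutoffWeight L M β μ Λ' ks.1 : ℂ)) *
        (((β * (L : ℝ) ^ 2 : ℝ) : ℂ) * ((Complex.I * matsubaraFreq β M ks.1.1 + nambuXi L μ ks.1.2) / nambuDen L M β μ 0 ks.1))) := by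
  rw [hubbardCovSlice, hubbardCovAbove_zero_seed, hubbardCovAbove_zero_seed, ← normalCovariance_sub_symbol]
  congr 1
  funext ks
  ring

end ZeroSeed

/-! ### The sectorised propagators of a normal covariance -/

section Pullback

variable {L M : ℕ} [NeZero L] {N : ℕ}

/-- Pulling back preserves antisymmetry: `(Sᵀ C S)ᵀ = Sᵀ Cᵀ S`. [folklore] -/
theorem transpose_transpose_mul_mul {m n : Type*} [Fintype m] [Fintype n] (S : Matrix m n ℂ) (C : Matrix m m ℂ) :
    (S.transpose * C * S).transpose = S.transpose * C.transpose * S := by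
  rw [Matrix.transpose_mul, Matrix.transpose_mul, Matrix.transpose_transpose, Matrix.mul_assoc]

/-- **The sectorised propagators of a normal covariance in closed form** (the lattice form of BGM 2006,
(2.66)–(2.67)): `C'((x,((ω,σ),c)),(y,((ω',σ'),c'))) = δ_{σσ'} Σ_k a^c_ω(k;x) [δ_{c0}δ_{c'1} - δ_{c1}δ_{c'0}] p(k,σ) a^{c'}_{ω'}(k;y)`
with `a^c_ω(k;x) = (βL²)⁻¹ F_ω(k) conj(e^{-is_c k·x})` — one momentum sum, cut off to the overlap of the two sectors.
[cite: BenfattoGiulianiMastropietro2006, §2.7 (2.66)] -/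
theorem sectorSub_pullback_normalCovariance_apply (β : ℝ) (F : Fin N → FreqMomentum L M → ℂ)
    (p : FreqMomentum L M × Fin 2 → ℂ) (Y Y' : SpaceTimeIdx L M × SectorLeg N) :
    ((sectorSubMatrix L M β F).transpose * normalCovariance L M p * sectorSubMatrix L M β F) Y Y' =
      if Y.2.1.2 = Y'.2.1.2 then
        ∑ k : FreqMomentum L M,
          (((1 / (β * (L : ℝ) ^ 2) : ℝ) : ℂ) * (F Y.2.1.1 k * (starRingEnd ℂ) (hubbardPlaneWave L M β Y.2.2 k Y.1))) *
            (if Y.2.2 = 0 ∧ Y'.2.2 = 1 then p (k, Y.2.1.2) else if Y.2.2 = 1 ∧ Y'.2.2 = 0 then -p (k, Y.2.1.2) else 0) *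
          (((1 / (β * (L : ℝ) ^ 2) : ℝ) : ℂ) * (F Y'.2.1.1 k * (starRingEnd ℂ) (hubbardPlaneWave L M β Y'.2.2 k Y'.1)))
        else 0 := by
  rw [sectorSub_pullback_apply]
  simp only [normalCovariance_apply, Prod.mk.injEq]
  by_cases hσ : Y.2.1.2 = Y'.2.1.2
  · rw [if_pos hσ]
    refine sum_congr rfl fun k _ => ?_
    rw [sum_eq_single_of_mem k (mem_univ _) fun k' _ hk' => by rw [if_neg (fun h => hk' h.1.symm), mul_zero, zero_mul]]
    rw [if_pos ⟨rfl, hσ⟩]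
  · rw [if_neg hσ]
    exact sum_eq_zero fun k _ => sum_eq_zero fun k' _ => by rw [if_neg (fun h => hσ h.2), mul_zero, zero_mul]

/-- **The CHARGE hypothesis**: the sectorised propagators of a normal covariance vanish between auxiliary fields of
equal charge. [cite: BenfattoGiulianiMastropietro2006, §2.7 (2.66)] -/
theorem pullback_normalCovariance_apply_of_charge_eq (β : ℝ) (F : Fin N → FreqMomentum L M → ℂ)
    (p : FreqMomentum L M × Fin 2 → ℂ) {Y Y' : SpaceTimeIdx L M × SectorLeg N} (h : Y.2.2 = Y'.2.2) :
    ((sectorSubMatrix L M β F).transpose * normalCovariance L M p * sectorSubMatrix L M β F) Y Y' = 0 := by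
  rw [sectorSub_pullback_normalCovariance_apply]
  by_cases hσ : Y.2.1.2 = Y'.2.1.2
  · rw [if_pos hσ]
    refine sum_eq_zero fun k _ => ?_
    rw [if_neg (fun h' => Fin.zero_ne_one (h'.1.symm.trans (h.trans h'.2))),
      if_neg (fun h' => Fin.zero_ne_one (h'.2.symm.trans (h.symm.trans h'.1))), mul_zero, zero_mul]
  · rw [if_neg hσ]

/-- The sectorised propagators of a normal covariance are antisymmetric. [folklore] -/
theorem pullback_normalCovariance_transpose (β : ℝ) (F : Fin N → FreqMomentum L M → ℂ)
    (p : FreqMomentum L M × Fin 2 → ℂ) :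
    ((sectorSubMatrix L M β F).transpose * normalCovariance L M p * sectorSubMatrix L M β F).transpose =
      -((sectorSubMatrix L M β F).transpose * normalCovariance L M p * sectorSubMatrix L M β F) := by
  rw [transpose_transpose_mul_mul, normalCovariance_transpose, Matrix.mul_neg, Matrix.neg_mul]

/-! ### The Gram form -/

/-- The scalar identity `√n · (√n · p / n) = p` for `n = ‖p‖` (both sides `0` at `p = 0`). [folklore] -/
theorem sqrt_mul_sqrt_mul_div_norm (p : ℂ) :
    ((Real.sqrt ‖p‖ : ℝ) : ℂ) * (((Real.sqrt ‖p‖ : ℝ) : ℂ) * p / (‖p‖ : ℂ)) = p := by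
  by_cases hp : p = 0
  · simp [hp]
  · have hn : (‖p‖ : ℂ) ≠ 0 := by exact_mod_cast (norm_pos_iff.2 hp).ne'
    rw [div_eq_mul_inv, ← mul_assoc, ← mul_assoc, ← Complex.ofReal_mul, Real.mul_self_sqrt (norm_nonneg _),
      mul_right_comm, mul_inv_cancel₀ hn, one_mul]

variable (L M)

/-- The left Gram vector of the auxiliary field `Y = (x, ((ω,σ),·))` (charge `0` legs):
`F_Y(k,s) = δ_{sσ} conj(a⁰_ω(k;x)) √‖p(k,σ)‖` in `ℓ²(FreqMomentum × spin)` (BGM 2006, (2.80); BGM 2003, (3.52)).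
[cite: BenfattoGiulianiMastropietro2006, §2.8 (2.80)] -/
def sectorGramF (β : ℝ) (F : Fin N → FreqMomentum L M → ℂ) (p : FreqMomentum L M × Fin 2 → ℂ)
    (Y : SpaceTimeIdx L M × SectorLeg N) : EuclideanSpace ℂ (FreqMomentum L M × Fin 2) :=
  WithLp.toLp 2 fun ks => if ks.2 = Y.2.1.2 then
    (starRingEnd ℂ) (((1 / (β * (L : ℝ) ^ 2) : ℝ) : ℂ) * (F Y.2.1.1 ks.1 * (starRingEnd ℂ) (hubbardPlaneWave L M β 0 ks.1 Y.1))) *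
      ((Real.sqrt ‖p ks‖ : ℝ) : ℂ) else 0

/-- The right Gram vector of the auxiliary field `Y' = (y, ((ω',σ'),·))` (charge `1` legs):
`G_{Y'}(k,s) = -δ_{sσ'} a¹_{ω'}(k;y) √‖p(k,σ')‖ p/‖p‖`. [cite: BenfattoGiulianiMastropietro2006, §2.8 (2.80)] -/
def sectorGramG (β : ℝ) (F : Fin N → FreqMomentum L M → ℂ) (p : FreqMomentum L M × Fin 2 → ℂ)
    (Y' : SpaceTimeIdx L M × SectorLeg N) : EuclideanSpace ℂ (FreqMomentum L M × Fin 2) :=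
  WithLp.toLp 2 fun ks => if ks.2 = Y'.2.1.2 then
    -((((1 / (β * (L : ℝ) ^ 2) : ℝ) : ℂ) * (F Y'.2.1.1 ks.1 * (starRingEnd ℂ) (hubbardPlaneWave L M β 1 ks.1 Y'.1))) *
      (((Real.sqrt ‖p ks‖ : ℝ) : ℂ) * p ks / (‖p ks‖ : ℂ))) else 0

variable {L M}

/-- **The inner product of the Gram vectors is minus the `(0,1)` sectorised propagator.** [cite: BenfattoGiulianiMastropietro2006, §2.8 (2.80)] -/
theorem inner_sectorGramF_sectorGramG (β : ℝ) (F : Fin N → FreqMomentum L M → ℂ) (p : FreqMomentum L M × Fin 2 → ℂ)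
    (Y Y' : SpaceTimeIdx L M × SectorLeg N) :
    ⟪sectorGramF L M β F p Y, sectorGramG L M β F p Y'⟫_ℂ =
      if Y.2.1.2 = Y'.2.1.2 then
        -∑ k : FreqMomentum L M,
          (((1 / (β * (L : ℝ) ^ 2) : ℝ) : ℂ) * (F Y.2.1.1 k * (starRingEnd ℂ) (hubbardPlaneWave L M β 0 k Y.1))) * p (k, Y.2.1.2) *
          (((1 / (β * (L : ℝ) ^ 2) : ℝ) : ℂ) * (F Y'.2.1.1 k * (starRingEnd ℂ) (hubbardPlaneWave L M β 1 k Y'.1)))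
        else 0 := by
  simp only [sectorGramF, sectorGramG, PiLp.inner_apply, RCLike.inner_apply]
  rw [Fintype.sum_prod_type_right]
  by_cases hσ : Y.2.1.2 = Y'.2.1.2
  · rw [if_pos hσ, sum_eq_single_of_mem Y.2.1.2 (mem_univ _) fun s _ hs => sum_eq_zero fun k _ => by
      simp [hs], ← sum_neg_distrib]
    refine sum_congr rfl fun k _ => ?_
    dsimp only
    rw [if_pos rfl, if_pos hσ, map_mul, Complex.conj_conj, Complex.conj_ofReal]
    have key := sqrt_mul_sqrt_mul_div_norm (p (k, Y.2.1.2))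
    linear_combination (-((((1 / (β * (L : ℝ) ^ 2) : ℝ) : ℂ) * (F Y.2.1.1 k * (starRingEnd ℂ) (hubbardPlaneWave L M β 0 k Y.1))) *
      (((1 / (β * (L : ℝ) ^ 2) : ℝ) : ℂ) * (F Y'.2.1.1 k * (starRingEnd ℂ) (hubbardPlaneWave L M β 1 k Y'.1))))) * key
  · rw [if_neg hσ]
    refine sum_eq_zero fun s _ => sum_eq_zero fun k _ => ?_
    dsimp only
    by_cases h1 : s = Y.2.1.2
    · rw [if_neg (fun h2 => hσ (h1.symm.trans h2)), zero_mul]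
    · rw [if_neg h1, map_zero, mul_zero]

/-- **The GRAM hypothesis**: for an auxiliary field `Y` of charge `0` and `Y'` of charge `1`, the two-point function of the
sectorised propagators of a normal covariance is the inner product of the Gram vectors,
`contr C' Y Y' = ⟪F_Y, G_{Y'}⟫` (BGM 2006, (2.80)). [cite: BenfattoGiulianiMastropietro2006, §2.8 (2.80)] -/
theorem contr_pullback_normalCovariance_eq_inner (β : ℝ) (F : Fin N → FreqMomentum L M → ℂ)
    (p : FreqMomentum L M × Fin 2 → ℂ) {Y Y' : SpaceTimeIdx L M × SectorLeg N} (hY : Y.2.2 = 0) (hY' : Y'.2.2 = 1) :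
    contr ℂ ((sectorSubMatrix L M β F).transpose * normalCovariance L M p * sectorSubMatrix L M β F) Y Y' =
      ⟪sectorGramF L M β F p Y, sectorGramG L M β F p Y'⟫_ℂ := by
  set C' := (sectorSubMatrix L M β F).transpose * normalCovariance L M p * sectorSubMatrix L M β F with hC'
  have hanti : C' Y' Y = -C' Y Y' := by
    have h := congrFun (congrFun (pullback_normalCovariance_transpose β F p) Y) Y'
    rwa [Matrix.transpose_apply, Matrix.neg_apply] at h
  rw [contr_apply, hanti, show ((1 / 2 : ℚ) • (1 : ℂ)) * (-C' Y Y' - C' Y Y') = -C' Y Y' by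
    rw [Rat.smul_one_eq_cast]; push_cast; ring]
  rw [hC', sectorSub_pullback_normalCovariance_apply, inner_sectorGramF_sectorGramG]
  simp only [hY, hY', and_self, if_true]
  split_ifs with hσ
  · rw [← sum_neg_distrib]
  · rw [neg_zero]

/-- **The norm of the left Gram vector is the sector phase-space sum of the symbol**:
`‖F_Y‖² = Σ_k ‖(βL²)⁻¹‖² ‖F_ω(k)‖² ‖p(k,σ)‖` (plane waves are unimodular; BGM 2006, (2.80): `≍ γ^{3h/2}` at scale `h`).
[cite: BenfattoGiulianiMastropietro2006, §2.8 (2.80)] -/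
theorem norm_sq_sectorGramF (β : ℝ) (F : Fin N → FreqMomentum L M → ℂ) (p : FreqMomentum L M × Fin 2 → ℂ)
    (Y : SpaceTimeIdx L M × SectorLeg N) :
    ‖sectorGramF L M β F p Y‖ ^ 2 =
      ∑ k : FreqMomentum L M, ‖((1 / (β * (L : ℝ) ^ 2) : ℝ) : ℂ)‖ ^ 2 * ‖F Y.2.1.1 k‖ ^ 2 * ‖p (k, Y.2.1.2)‖ := by
  rw [EuclideanSpace.norm_eq, Real.sq_sqrt (sum_nonneg fun _ _ => by positivity), Fintype.sum_prod_type_right,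
    sum_eq_single_of_mem Y.2.1.2 (mem_univ _) fun s _ hs => sum_eq_zero fun k _ => by simp [sectorGramF, hs]]
  refine sum_congr rfl fun k _ => ?_
  simp only [sectorGramF, WithLp.ofLp_toLp, if_true, norm_mul, Complex.norm_conj, norm_hubbardPlaneWave, mul_one,
    Complex.norm_real, Real.norm_eq_abs, abs_of_nonneg (Real.sqrt_nonneg _)]
  rw [mul_pow, mul_pow, Real.sq_sqrt (norm_nonneg _)]

/-- **The norm of the right Gram vector is the same sector phase-space sum.** [cite: BenfattoGiulianiMastropietro2006, §2.8 (2.80)] -/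
theorem norm_sq_sectorGramG (β : ℝ) (F : Fin N → FreqMomentum L M → ℂ) (p : FreqMomentum L M × Fin 2 → ℂ)
    (Y' : SpaceTimeIdx L M × SectorLeg N) :
    ‖sectorGramG L M β F p Y'‖ ^ 2 =
      ∑ k : FreqMomentum L M, ‖((1 / (β * (L : ℝ) ^ 2) : ℝ) : ℂ)‖ ^ 2 * ‖F Y'.2.1.1 k‖ ^ 2 * ‖p (k, Y'.2.1.2)‖ := by
  rw [EuclideanSpace.norm_eq, Real.sq_sqrt (sum_nonneg fun _ _ => by positivity), Fintype.sum_prod_type_right,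
    sum_eq_single_of_mem Y'.2.1.2 (mem_univ _) fun s _ hs => sum_eq_zero fun k _ => by simp [sectorGramG, hs]]
  refine sum_congr rfl fun k _ => ?_
  simp only [sectorGramG, WithLp.ofLp_toLp, if_true, norm_neg, norm_mul, norm_div, Complex.norm_conj,
    norm_hubbardPlaneWave, mul_one, Complex.norm_real, Real.norm_eq_abs, abs_of_nonneg (Real.sqrt_nonneg _),
    abs_of_nonneg (norm_nonneg _)]
  by_cases hp : p (k, Y'.2.1.2) = 0
  · simp [hp]
  · have hn : 0 < ‖p (k, Y'.2.1.2)‖ := norm_pos_iff.2 hp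
    rw [mul_div_assoc, div_self hn.ne', mul_one, mul_pow, mul_pow, Real.sq_sqrt hn.le]

end Pullback

end Literature.MathematicalPhysics.QuantumLattice
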